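import Literature.Analysis.FluidPDE.ExtremeGrowthBounds
import Literature.Analysis.FluidPDE.ExtremeGrowthBoundsProofs
import Literature.Analysis.FunctionSpaces.TorusClassicalNSGluing
import HarnessLib

/-!
# Functional mining: ν-dependent Lyapunov functionals (the saturating class EK / shape T_LD)

Search for candidate a priori estimates; no regularity claim.

Cell `pub-nsfunc` (host summit NavierStokesRegularity, topic `FunctionalMining`). By the parity
sieve (`Sieves.lean`, `RateBudgets.lean`) strict monotonicity along every solution is empty on
the even amplitude-homogeneous class except for Euler invariants; what survives is the
SATURATING class of the dictionary (DICTIONARY.md §7 T_LD, §8 family EK):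
`M_F = K − κ ν^{a_F} F^{−1/σ_F}`, inhomogeneous and `ν`-dependent, whose monotonicity is
equivalent to the Lu–Doering-shaped rate law `dF/dt ≤ (σ_F/κ) ν^{1−a_F} ‖∇u‖₂² F^{1+1/σ_F}` and
closes for small data only. This file fixes the template for such rows and its calibration member:

* `IsLyapunov M` — for `M ν v` depending on the viscosity and the field: along every zero-mean
  classical solution of unforced Navier–Stokes on `T³ × [a, b]`, `t ↦ M ν (u t)` is antitone on
  `[a, b]`;
* `kineticEnergy_isLyapunov` — positive control `M = K`;
* `luDoering_lyapunov_of_pos` — the calibration member of family EK, CONDITIONAL on the tree's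
  named fact `LuDoering2008_enstrophyRate_le`: along every zero-mean classical solution with
  positive enstrophy on the window, `t ↦ K(u t) − (2ν/C_LD(ν)) · ℰ(u t)⁻¹` is antitone
  (`2ν/C_LD(ν) = 16π⁴ν⁴/27`, `two_mul_div_luDoeringConst`), i.e. `M_ℰ = K − κν⁴/ℰ` with
  `κ = 16π⁴/27` is a Lyapunov functional — a rewriting of Ayala–Protas 2017 (2.10)
  (tree `inv_torusEnstrophy_sub_inv_le`). The census must rediscover it (row P0-04, control+) and
  must see violations for `κ` below the Lu–Doering value on the extreme-growth data.

Deliberately NOT here: the `IsLyapunov` instance form of the Lu–Doering member (it needs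
"positive enstrophy persists", i.e. backward uniqueness, to dispose of degenerate windows), and any
other member of EK (their optimal `κ(F)` is what the census measures).
-/

noncomputable section

open MeasureTheory Set Filter
open scoped Topology InnerProductSpace RealInnerProductSpace

namespace Summit.NavierStokesRegularity.FunctionalMining

open Literature.Analysis.FunctionSpaces Literature.Analysis.FluidPDE

variable {d : Type*} [Fintype d] [DecidableEq d]

/-- **Lyapunov functional along Navier–Stokes (census template, saturating class).** For
`M ν v` (viscosity-dependent): on the 3-torus, for every `ν > 0`, `a < b` and every zero-mean
classical solution `(u, p)` of unforced Navier–Stokes on `T³ × [a, b]`, the function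
`t ↦ M ν (u t)` is antitone on `[a, b]`. -/
def IsLyapunov (M : ℝ → (UnitAddTorus d → EuclideanSpace ℝ d) → ℝ) : Prop :=
  Fintype.card d = 3 → ∀ ⦃ν : ℝ⦄, 0 < ν → ∀ ⦃a b : ℝ⦄, a < b →
    ∀ ⦃u : ℝ → UnitAddTorus d → EuclideanSpace ℝ d⦄ ⦃p : ℝ → UnitAddTorus d → ℝ⦄,
      Torus.IsClassicalNSSolutionOn (Icc a b) ν 0 u p →
      (∀ t ∈ Icc a b, Torus.HasZeroMean (u t)) →
      AntitoneOn (fun t => M ν (u t)) (Icc a b)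

/-- Sums of Lyapunov functionals are Lyapunov. [folklore] -/
theorem IsLyapunov.add {M₁ M₂ : ℝ → (UnitAddTorus d → EuclideanSpace ℝ d) → ℝ}
    (h₁ : IsLyapunov M₁) (h₂ : IsLyapunov M₂) : IsLyapunov (fun ν v => M₁ ν v + M₂ ν v) :=
  fun hd _ hν _ _ hab _ _ hsol hmean _ hs _ ht hst =>
    add_le_add (h₁ hd hν hab hsol hmean hs ht hst) (h₂ hd hν hab hsol hmean hs ht hst)

/-! ## Positive control: the kinetic energy -/

/-- **Positive control: `M = K` is a Lyapunov functional** (energy balance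
`dK/dt = −ν‖∇u‖₂² ≤ 0`, `Torus.IsClassicalNSSolutionOn.energy_balance_holds`). [folklore] -/
theorem kineticEnergy_isLyapunov : IsLyapunov (d := d) (fun _ v => Torus.kineticEnergy v) := by
  intro _ ν hν a b _ u p hsol _
  have hK : ∀ s ∈ Icc a b, HasDerivWithinAt (fun r => Torus.kineticEnergy (u r))
      (-ν * Torus.gradNormSq (u s)) (Icc a b) s := by
    intro s hs
    have hb := Torus.IsClassicalNSSolutionOn.energy_balance_holds hsol (convex_Icc a b) hs
    simpa using hb
  refine antitoneOn_of_hasDerivWithinAt_nonpos (convex_Icc a b)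
    (fun s hs => (hK s hs).continuousWithinAt)
    (fun s hs => (hK s (interior_subset hs)).mono interior_subset) fun s _ => ?_
  have := Torus.gradNormSq_nonneg (u s)
  nlinarith [hν.le]

/-! ## The calibration member of the saturating class -/

/-- `2ν / C_LD(ν) = 16π⁴ν⁴/27` (`C_LD = 27/(8π⁴ν³)`). [folklore] -/
theorem two_mul_div_luDoeringConst {ν : ℝ} (hν : ν ≠ 0) :
    2 * ν / luDoeringConst ν = 16 * Real.pi ^ 4 * ν ^ 4 / 27 := by
  unfold luDoeringConst
  have hπ : Real.pi ≠ 0 := Real.pi_ne_zero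
  field_simp
  ring

/-- **The Lu–Doering Lyapunov functional (conditional).** Under the tree's named fact
`LuDoering2008_enstrophyRate_le`, along every zero-mean classical solution of unforced
Navier–Stokes on `T³ × [a, b]` with positive enstrophy on the window, the function
`t ↦ K(u t) − (2ν/C_LD(ν)) · (ℰ(u t))⁻¹` is antitone on `[a, b]` — `M_ℰ = K − (16π⁴/27) ν⁴/ℰ`
is a Lyapunov functional (Ayala–Protas 2017, (2.10), rearranged: `1/ℰ(s) − 1/ℰ(t) ≤
(C_LD/(2ν))(K(s) − K(t))` for `s ≤ t`, tree `inv_torusEnstrophy_sub_inv_le` on the window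
`[s, b]`). CONDITIONAL: `hLD` is an undischarged named fact. [folklore] -/
theorem luDoering_lyapunov_of_pos (hLD : LuDoering2008_enstrophyRate_le (d := d))
    (hd : Fintype.card d = 3) {ν a b : ℝ} (hν : 0 < ν)
    {u : ℝ → UnitAddTorus d → EuclideanSpace ℝ d} {p : ℝ → UnitAddTorus d → ℝ}
    (hsol : Torus.IsClassicalNSSolutionOn (Icc a b) ν 0 u p)
    (hmean : ∀ t ∈ Icc a b, Torus.HasZeroMean (u t))
    (hpos : ∀ t ∈ Icc a b, 0 < torusEnstrophy (u t)) :
    AntitoneOn (fun t => Torus.kineticEnergy (u t) - 2 * ν / luDoeringConst ν * (torusEnstrophy (u t))⁻¹)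
      (Icc a b) := by
  intro s hs t ht hst
  rcases eq_or_lt_of_le hst with rfl | hlt
  · exact le_rfl
  -- restrict to the window `[s, b]` and apply Ayala–Protas (2.10) there
  have hsub : Icc s b ⊆ Icc a b := Icc_subset_Icc_left hs.1
  have hsb : s < b := lt_of_lt_of_le hlt ht.2
  have hsol' := hsol.mono hsub (uniqueDiffOn_Icc hsb)
  have hmean' : ∀ r ∈ Icc s b, Torus.HasZeroMean (u r) := fun r hr => hmean r (hsub hr)
  have hpos' : ∀ r ∈ Icc s b, 0 < torusEnstrophy (u r) := fun r hr => hpos r (hsub hr)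
  have hts : t ∈ Icc s b := ⟨hst, ht.2⟩
  have hineq := inv_torusEnstrophy_sub_inv_le hLD hd hν hsb hsol' hmean' hpos' hts
  have hC : 0 < luDoeringConst ν := luDoeringConst_pos hν
  have hc : 0 < luDoeringConst ν / (2 * ν) := div_pos hC (by positivity)
  -- multiply (2.10) by `2ν/C_LD > 0` and rearrange
  have hkey : 2 * ν / luDoeringConst ν * ((torusEnstrophy (u s))⁻¹ - (torusEnstrophy (u t))⁻¹) ≤
      Torus.kineticEnergy (u s) - Torus.kineticEnergy (u t) := by
    have h2 : 2 * ν / luDoeringConst ν * (luDoeringConst ν / (2 * ν)) = 1 := by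
      field_simp
    calc 2 * ν / luDoeringConst ν * ((torusEnstrophy (u s))⁻¹ - (torusEnstrophy (u t))⁻¹)
        ≤ 2 * ν / luDoeringConst ν *
            (luDoeringConst ν / (2 * ν) * (Torus.kineticEnergy (u s) - Torus.kineticEnergy (u t))) :=
          mul_le_mul_of_nonneg_left hineq (by positivity)
      _ = Torus.kineticEnergy (u s) - Torus.kineticEnergy (u t) := by
          rw [← mul_assoc, h2, one_mul]
  show Torus.kineticEnergy (u t) - 2 * ν / luDoeringConst ν * (torusEnstrophy (u t))⁻¹ ≤
    Torus.kineticEnergy (u s) - 2 * ν / luDoeringConst ν * (torusEnstrophy (u s))⁻¹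
  nlinarith [hkey]


/-- **The Lu–Doering Lyapunov functional — UNCONDITIONAL (referee F9.3; κ-direction F4.2).** The
named fact `LuDoering2008_enstrophyRate_le` is DISCHARGED in the tree
(`LuDoering2008_enstrophyRate_le_holds`, lit seat, `FluidPDE/ExtremeGrowthBoundsProofs`), so: along
every zero-mean classical solution of unforced Navier–Stokes on `T³ × [a, b]` with positive enstrophy
on the window, `t ↦ K(u t) − (2ν/C_LD(ν))·ℰ(u t)⁻¹ = K − (16π⁴/27)ν⁴/ℰ` is antitone. Convention note
(REFEREE F4.2): in the COEFFICIENT form `M_ℰ(κ) = K − κν⁴/ℰ` this holds for every `κ ≤ 16π⁴/27`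
(larger coefficient = stronger statement); in the dictionary's RATE-constant convention
(`SaturatingLaw`, K0-SPEC: `dℰ/dt ≤ κ_rate ν^{-3}(2ℰ)ℰ²`) the same fact reads "for every
`κ_rate ≥ 27/(16π⁴)`" (larger rate constant = weaker, `SaturatingLaw.mono_kappa`); the census therefore
expects NO violation at or above the Lu–Doering rate constant and measures depletion below it.
Search for candidate a priori estimates; no regularity claim. [folklore] -/
theorem luDoering_lyapunov_holds (hd : Fintype.card d = 3) {ν a b : ℝ} (hν : 0 < ν)
    {u : ℝ → UnitAddTorus d → EuclideanSpace ℝ d} {p : ℝ → UnitAddTorus d → ℝ}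
    (hsol : Torus.IsClassicalNSSolutionOn (Icc a b) ν 0 u p)
    (hmean : ∀ t ∈ Icc a b, Torus.HasZeroMean (u t))
    (hpos : ∀ t ∈ Icc a b, 0 < torusEnstrophy (u t)) :
    AntitoneOn (fun t => Torus.kineticEnergy (u t) - 2 * ν / luDoeringConst ν * (torusEnstrophy (u t))⁻¹)
      (Icc a b) :=
  luDoering_lyapunov_of_pos LuDoering2008_enstrophyRate_le_holds hd hν hsol hmean hpos

end Summit.NavierStokesRegularity.FunctionalMining

end
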